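import Summits.ValiantsHypothesis.ValiantsHypothesis.Theorems.BarrierLeverDefinableDcEquationsPencilAtInfinity
import Summits.ValiantsHypothesis.ValiantsHypothesis.Theorems.BarrierLeverDefinableDcEquationsDegreeTrading
import Literature.Computability.AlgebraicComplexity.DeterminantalConormalBoundProofs
import Literature.Computability.AlgebraicComplexity.LRPencilOfMatrix
import Literature.Computability.AlgebraicComplexity.PencilFamily

/-!
# Route BarrierLever — the top form of a degree-`n` polynomial of determinantal complexity
# `n + k` in `w ≥ 2k + 7` variables is a SINGULAR cone (crux `DefinableDcEquations`, stmt-8746)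

Kumar–Volk-type sharpening of `BarrierLeverDefinableDcEquationsConstantExcess.lean` (window
`2k + 7` instead of `(k+2)² + 1`).  `exists_ne_zero_grad_eq_zero_of_decomposition` (case B engine):
if `F = Σ_o P_o Q_o + N₀₀` with `t` pairs of constant-free factors, `deg N₀₀ < n`, `deg F ≤ n`,
`w > 2t`, then `∇ hc_n F` has a nonzero common zero — the homogenised factors generate a
homogeneous ideal `𝔞` of height `≤ 2t` with `x₀ ∉ √𝔞`; a minimal prime `𝔭 ∌ x₀` of `𝔞` contains
the `x`-gradient of `homogenizeTo n (F - N₀₀)` (cancel `x₀`), and the cone `V(𝔭)` meets `x₀ = 0`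
(`exists_ne_zero_none_eq_zero_of_isPrime`).  `exists_ne_zero_grad_eq_zero_caseB`: fed by the
Kumar–Volk decomposition (`exists_sum_mul_decomposition`).
**`exists_ne_zero_grad_topForm_det_eq_zero`**: for EVERY affine `A` of size `n + k` over
`ℂ[x₁..x_w]` with `deg det A ≤ n`, `n ≥ 3`, `w ≥ 2k + 7`, `∇ hc_n (det A)` has a nonzero common
zero — dichotomy on the pencil `x₀ A₀ + A₁(x)`: a minimal prime of its submaximal minors misses
`x₀` (case A, `PencilAtInfinity`), or the affine matrix has corank `≤ 1` everywhere; then translate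
to a zero `v` of `det A` by the LINEAR substitution `x ↦ x + x₀ v` (it fixes the hyperplane at
infinity, hence the top form) and run case B on `A(v) + A₁(x)`.

Honest framing: the mechanism of Kumar–Volk 2022 §3 for arbitrary `f` (the paper treats `Σ xᵢⁿ`);
the output is a CLOSED CONDITION on `{deg ≤ n, dc ≤ n + k}` (an algebraic natural proof, next
file), not a new lower bound.  Nothing here bears on `VP` vs `VNP`.  No definitions, no named-fact
hypotheses; standard axioms.

References: M. Kumar, B. L. Volk, comput. complexity 31 (2022) 12 = arXiv:2009.02452, §3
[KumarVolk2022b]; J. Alper, T. Bogart, M. Velasco, Found. Comput. Math. 17 (2017), Prop. 2.1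
[AlperBogartVelasco2017].
-/

-- layout Summits/ValiantsHypothesis/ValiantsHypothesis forces the duplicated namespace component
set_option linter.dupNamespace false

noncomputable section

open MvPolynomial Matrix

namespace Summit.ValiantsHypothesis.ValiantsHypothesis.Theorems.BarrierLever.DcConstantExcess

open Literature.RingTheory.MvPolynomial.IdealHomogenization
open Literature.Computability.AlgebraicComplexity
open Literature.Computability.AlgebraicComplexity.KumarVolk
open Literature.RingTheory.MvPolynomial

variable {w : ℕ}

/-! ## §1 Homogenised constant-free polynomials vanish on the `x₀`-axis -/

/-- Substituting `x_i ↦ 0` (all `i`) and `x₀ ↦ X` kills the padded homogenization of a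
constant-free polynomial. [cite: CoxLittleOShea2007, Ch.8 §2 Prop. 7 (i)] -/
theorem aeval_axis_homogenizeTo_eq_zero {E : ℕ} (p : MvPolynomial (Fin w) ℂ)
    (hp : constantCoeff p = 0) :
    aeval (fun o : Option (Fin w) => (o.elim (X ()) (fun _ => 0) : MvPolynomial Unit ℂ))
      (homogenizeTo E p) = 0 := by
  classical
  unfold homogenizeTo
  rw [map_sum]
  refine Finset.sum_eq_zero fun α hα => ?_
  rw [aeval_monomial, Finsupp.prod_option_index _
    (fun o n => ((o.elim (X ()) (fun _ => 0) : MvPolynomial Unit ℂ)) ^ n) (fun _ => pow_zero _)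
    (fun _ _ _ => pow_add _ _ _)]
  simp only [Option.elim_none, Option.elim_some, Finsupp.optionElim_apply_none,
    Finsupp.some_optionElim]
  have hα0 : α ≠ 0 := by
    intro h
    rw [h, MvPolynomial.mem_support_iff] at hα
    exact hα (by simpa [constantCoeff_eq] using hp)
  obtain ⟨i, hi⟩ : ∃ i, α i ≠ 0 := by
    by_contra h
    push Not at h
    exact hα0 (Finsupp.ext h)
  have hprod : (α.prod fun (_ : Fin w) (n : ℕ) => ((0 : MvPolynomial Unit ℂ)) ^ n) = 0 := by
    rw [Finsupp.prod]
    exact Finset.prod_eq_zero (Finsupp.mem_support_iff.2 hi) (zero_pow hi)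
  rw [hprod, mul_zero, mul_zero]

/-! ## §2 Case B engine: a sum-of-products decomposition forces singular points at infinity -/

/-- **Case B engine.**  Let `F = Σ_{o : ι} P_o Q_o + N₀₀` in `ℂ[x₁..x_w]` with all `P_o, Q_o`
constant free (degrees `≤ E`), `deg N₀₀ < n`, `deg F ≤ n ≤ 2E`, and `2·#ι < w`.  Then the
gradient of the degree-`n` component of `F` has a NONZERO common zero (mechanism in the module
docstring). [cite: KumarVolk2022b, Lemma 11 and §3.3] -/
theorem exists_ne_zero_grad_eq_zero_of_decomposition {ι : Type} [Fintype ι] {n E : ℕ}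
    (hw : 2 * Fintype.card ι < w) (F N₀₀ : MvPolynomial (Fin w) ℂ)
    (P Q : ι → MvPolynomial (Fin w) ℂ) (hP0 : ∀ o, constantCoeff (P o) = 0)
    (hQ0 : ∀ o, constantCoeff (Q o) = 0) (hPdeg : ∀ o, (P o).totalDegree ≤ E)
    (hQdeg : ∀ o, (Q o).totalDegree ≤ E) (hN : N₀₀.totalDegree < n) (hFdeg : F.totalDegree ≤ n)
    (hnE : n ≤ 2 * E) (hid : F = ∑ o, P o * Q o + N₀₀) :
    ∃ ζ : Fin w → ℂ, ζ ≠ 0 ∧ ∀ i, eval ζ (pderiv i (homogeneousComponent n F)) = 0 := by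
  classical
  letI : GradedAlgebra (homogeneousSubmodule (Option (Fin w)) ℂ) := MvPolynomial.gradedAlgebra
  let a : ι → MvPolynomial (Option (Fin w)) ℂ := fun o => homogenizeTo E (P o)
  let b : ι → MvPolynomial (Option (Fin w)) ℂ := fun o => homogenizeTo E (Q o)
  let s : Finset (MvPolynomial (Option (Fin w)) ℂ) := Finset.univ.image a ∪ Finset.univ.image b
  set 𝔞 : Ideal (MvPolynomial (Option (Fin w)) ℂ) := Ideal.span (s : Set _) with h𝔞
  have hscard : s.card ≤ 2 * Fintype.card ι := by
    refine (Finset.card_union_le _ _).trans ?_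
    have h1 := Finset.card_image_le (s := Finset.univ) (f := a)
    have h2 := Finset.card_image_le (s := Finset.univ) (f := b)
    rw [Finset.card_univ] at h1 h2
    omega
  have ha : ∀ o, a o ∈ 𝔞 := fun o => Ideal.subset_span (Finset.mem_coe.2
    (Finset.mem_union_left _ (Finset.mem_image_of_mem _ (Finset.mem_univ o))))
  have hb : ∀ o, b o ∈ 𝔞 := fun o => Ideal.subset_span (Finset.mem_coe.2
    (Finset.mem_union_right _ (Finset.mem_image_of_mem _ (Finset.mem_univ o))))
  have h𝔞hom : 𝔞.IsHomogeneous (homogeneousSubmodule (Option (Fin w)) ℂ) := by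
    refine Ideal.homogeneous_span (𝒜 := homogeneousSubmodule (Option (Fin w)) ℂ) _ ?_
    intro x hx
    rw [Finset.mem_coe, Finset.mem_union, Finset.mem_image, Finset.mem_image] at hx
    rcases hx with ⟨o, -, rfl⟩ | ⟨o, -, rfl⟩
    · exact ⟨E, (mem_homogeneousSubmodule E _).2 (homogenizeTo_isHomogeneous (hPdeg o))⟩
    · exact ⟨E, (mem_homogeneousSubmodule E _).2 (homogenizeTo_isHomogeneous (hQdeg o))⟩
  have hrad : (X none : MvPolynomial (Option (Fin w)) ℂ) ∉ 𝔞.radical := by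
    intro h
    obtain ⟨N, hN⟩ := Ideal.mem_radical_iff.1 h
    let φ : MvPolynomial (Option (Fin w)) ℂ →ₐ[ℂ] MvPolynomial Unit ℂ :=
      aeval fun o : Option (Fin w) => (o.elim (X ()) (fun _ => 0) : MvPolynomial Unit ℂ)
    have hmap : 𝔞.map (φ : MvPolynomial (Option (Fin w)) ℂ →+* MvPolynomial Unit ℂ) = ⊥ := by
      rw [h𝔞, Ideal.map_span, Ideal.span_eq_bot]
      rintro _ ⟨x, hx, rfl⟩
      rw [Finset.mem_coe, Finset.mem_union, Finset.mem_image, Finset.mem_image] at hx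
      rcases hx with ⟨o, -, rfl⟩ | ⟨o, -, rfl⟩
      · exact aeval_axis_homogenizeTo_eq_zero _ (hP0 o)
      · exact aeval_axis_homogenizeTo_eq_zero _ (hQ0 o)
    have h0 : φ (X none ^ N) = 0 := by
      have := Ideal.mem_map_of_mem (φ : MvPolynomial (Option (Fin w)) ℂ →+* MvPolynomial Unit ℂ) hN
      rw [hmap, Ideal.mem_bot] at this
      exact this
    rw [map_pow, show φ (X none) = X () by simp [φ]] at h0
    exact (pow_ne_zero N (X_ne_zero ())) h0
  obtain ⟨𝔭, h𝔭, hX⟩ : ∃ 𝔭 : Ideal (MvPolynomial (Option (Fin w)) ℂ),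
      𝔭 ∈ 𝔞.minimalPrimes ∧ (X none : MvPolynomial (Option (Fin w)) ℂ) ∉ 𝔭 := by
    rw [← Ideal.sInf_minimalPrimes, Submodule.mem_sInf] at hrad
    push Not at hrad
    exact hrad
  haveI h𝔭p : 𝔭.IsPrime := h𝔭.1.1
  have h𝔞𝔭 : 𝔞 ≤ 𝔭 := h𝔭.1.2
  have h𝔭hom : 𝔭.IsHomogeneous (homogeneousSubmodule (Option (Fin w)) ℂ) :=
    isHomogeneous_of_mem_minimalPrimes h𝔞hom h𝔭
  have hht : 𝔭.height < w := by
    have h1 : 𝔭.height ≤ s.card := Ideal.height_le_card_of_mem_minimalPrimes_span_finset h𝔭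
    have h2 : ((s.card : ℕ) : ℕ∞) ≤ ((2 * Fintype.card ι : ℕ) : ℕ∞) := by exact_mod_cast hscard
    have h3 : ((2 * Fintype.card ι : ℕ) : ℕ∞) < ((w : ℕ) : ℕ∞) := by exact_mod_cast hw
    exact lt_of_le_of_lt (h1.trans h2) h3
  have hdeg' : (F - N₀₀).totalDegree ≤ n :=
    (totalDegree_sub _ _).trans (max_le hFdeg hN.le)
  set H' := homogenizeTo n (F - N₀₀) with hH'
  have hsum : ∑ o, a o * b o = X none ^ (2 * E - n) * H' := by
    have h1 : ∑ o, a o * b o = homogenizeTo (2 * E) (F - N₀₀) := by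
      refine eq_homogenizeTo_of_isHomogeneous ?_ ?_
      · rw [show 2 * E = E + E by ring]
        exact IsHomogeneous.sum _ _ _ fun o _ =>
          (homogenizeTo_isHomogeneous (hPdeg o)).mul (homogenizeTo_isHomogeneous (hQdeg o))
      · rw [map_sum]
        simp only [a, b, map_mul, dehomogenization_homogenizeTo]
        rw [hid, add_sub_cancel_right]
    rw [h1, hH', show 2 * E = n + (2 * E - n) by omega, homogenizeTo_add_right hdeg']
    congr 2
    omega
  have hdH : ∀ i : Fin w, pderiv (some i) H' ∈ 𝔭 := by
    intro i
    have hmem : pderiv (some i) (∑ o, a o * b o) ∈ 𝔞 := by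
      rw [map_sum]
      refine Ideal.sum_mem _ fun o _ => ?_
      rw [(pderiv (some i)).leibniz, smul_eq_mul, smul_eq_mul]
      exact Ideal.add_mem _ (Ideal.mul_mem_right _ _ (ha o)) (Ideal.mul_mem_right _ _ (hb o))
    rw [hsum, (pderiv (some i)).leibniz, smul_eq_mul, smul_eq_mul, (pderiv (some i)).leibniz_pow,
      pderiv_X, Pi.single_eq_of_ne (by simp : (none : Option (Fin w)) ≠ some i), smul_zero,
      smul_zero, mul_zero, add_zero] at hmem
    rcases h𝔭p.mem_or_mem (h𝔞𝔭 hmem) with h1 | h2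
    · exact absurd (h𝔭p.mem_of_pow_mem _ h1) hX
    · exact h2
  obtain ⟨ξ, hξ0, hξn, hξ⟩ := exists_ne_zero_none_eq_zero_of_isPrime h𝔭hom hX hht
  refine ⟨ξ ∘ some, hξ0, fun i => ?_⟩
  have hξeq : ξ = fun o : Option (Fin w) => (o.elim 0 (ξ ∘ some) : ℂ) := by
    funext o; cases o with
    | none => exact hξn
    | some j => rfl
  have h := hξ _ (hdH i)
  rw [hξeq, eval_elim_zero, aeval_elim_zero_pderiv_some, hH', aeval_elim_zero_homogenizeTo _ hdeg',
    map_sub, homogeneousComponent_eq_zero n N₀₀ hN, sub_zero] at h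
  exact h

/-- **Case B for an affine matrix in block shape.**  An affine matrix of size `(k'+1) + (s+1)`
(`k' ≥ 1`) over `ℂ[x₁..x_w]`, `w ≥ 2k' + 5`, whose determinant vanishes at the origin, has degree
`≤ s + 3`, and whose constant part has corank exactly one, has a top form (degree `s + 3`) with a
singular cone: Kumar–Volk decomposition + the case B engine. [cite: KumarVolk2022b, §3.3] -/
theorem exists_ne_zero_grad_eq_zero_caseB {s k' : ℕ} (hk : 1 ≤ k') (hw : 2 * k' + 5 ≤ w)
    (M : Matrix (Fin ((k' + 1) + (s + 1))) (Fin ((k' + 1) + (s + 1))) (MvPolynomial (Fin w) ℂ))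
    (hM : ∀ i j, (M i j).totalDegree ≤ 1) (h0 : constantCoeff M.det = 0)
    (hrank : (constPart M).rank = k' + (s + 1)) (hdeg : M.det.totalDegree ≤ s + 3) :
    ∃ ζ : Fin w → ℂ, ζ ≠ 0 ∧ ∀ i, eval ζ (pderiv i (homogeneousComponent (s + 3) M.det)) = 0 := by
  obtain ⟨P, Qq, N₀₀, hP0, hQ0, hPdeg, hQdeg, hN, hid⟩ :=
    exists_sum_mul_decomposition hk M hM h0 hrank
  refine exists_ne_zero_grad_eq_zero_of_decomposition (ι := Option (Fin (k' + 1)))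
    (E := (k' + 2) * (s + 3)) ?_ M.det N₀₀ P Qq hP0 hQ0 hPdeg hQdeg (by omega) hdeg (by nlinarith) hid
  rw [Fintype.card_option, Fintype.card_fin]
  omega

/-! ## §3 Translation in homogeneous coordinates and the dichotomy -/

/-- The pencil entry of an affine polynomial `p = p₀ + ℓ`: `homogenizeTo 1 p = p₀ x₀ + ℓ(x)`.
[cite: CoxLittleOShea2007, Ch.8 §2 Prop. 7 (iv)] -/
theorem homogenizeTo_one_eq (p : MvPolynomial (Fin w) ℂ) (hp : p.totalDegree ≤ 1) :
    homogenizeTo 1 p = C (coeff 0 p) * X none + rename some (homogeneousComponent 1 p) := by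
  symm
  refine eq_homogenizeTo_of_isHomogeneous ?_ ?_
  · refine IsHomogeneous.add ?_ ?_
    · simpa using (isHomogeneous_C (Option (Fin w)) (coeff 0 p)).mul (isHomogeneous_X ℂ none)
    · exact (homogeneousComponent_isHomogeneous 1 p).rename_isHomogeneous
  · rw [map_add, map_mul, dehomogenization_C, dehomogenization_X_none, mul_one]
    have h : dehomogenization (rename some (homogeneousComponent 1 p)) = homogeneousComponent 1 p := by
      rw [dehomogenization, aeval_rename]
      exact aeval_X_left_apply _
    rw [h]
    conv_rhs => rw [eq_homogeneousComponent_zero_add_one hp, homogeneousComponent_zero]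

/-- The translation `x ↦ x + x₀ v` of the homogeneous coordinates on a linear form `ℓ(x)`:
`ℓ(x + x₀ v) = ℓ(x) + ℓ(v) x₀`. [folklore] -/
theorem aeval_translate_rename_of_isHomogeneous_one (v : Fin w → ℂ) (ℓ : MvPolynomial (Fin w) ℂ)
    (hℓ : ℓ.totalDegree ≤ 1) (hℓ0 : coeff 0 ℓ = 0) :
    aeval (fun o : Option (Fin w) =>
        (o.elim (X none) (fun i => X (some i) + C (v i) * X none) : MvPolynomial (Option (Fin w)) ℂ))
      (rename some ℓ) = rename some ℓ + C (eval v ℓ) * X none := by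
  classical
  rw [aeval_rename]
  conv_lhs => rw [LRPencil.eq_affine_of_totalDegree_le_one ℓ hℓ]
  conv_rhs => rw [LRPencil.eq_affine_of_totalDegree_le_one ℓ hℓ]
  simp only [hℓ0, C_0, zero_add, map_sum, map_mul, aeval_C, algebraMap_eq, Function.comp_apply,
    aeval_X, Option.elim_some, rename_C, rename_X, eval_C, eval_X]
  rw [Finset.sum_mul, ← Finset.sum_add_distrib]
  refine Finset.sum_congr rfl fun i _ => ?_
  ring

/-- A nonconstant polynomial over `ℂ` has a zero. [folklore] -/
theorem exists_eval_eq_zero_of_totalDegree_ne_zero (f : MvPolynomial (Fin w) ℂ)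
    (hf : f.totalDegree ≠ 0) : ∃ v : Fin w → ℂ, eval v f = 0 := by
  have hunit : ¬ IsUnit f := fun h =>
    hf (MvPolynomial.isUnit_iff_totalDegree_of_isReduced.1 h).2
  have htop : Ideal.span {f} ≠ ⊤ := by
    rw [Ne, Ideal.span_singleton_eq_top]
    exact hunit
  obtain ⟨𝔪, h𝔪, hf𝔪⟩ := Ideal.exists_le_maximal _ htop
  obtain ⟨v, hv⟩ := (MvPolynomial.isMaximal_iff_eq_vanishingIdeal_singleton (I := 𝔪)).1 h𝔪
  refine ⟨v, ?_⟩
  have h := hf𝔪 (Ideal.mem_span_singleton_self f)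
  rw [hv, MvPolynomial.mem_vanishingIdeal_iff] at h
  simpa using h v rfl

/-- **The top form of a polynomial of determinantal complexity `n + k` is a singular cone** (in
`w ≥ 2k + 7` variables, `n ≥ 3`): for every affine matrix `A` of size `n + k` over `ℂ[x₁..x_w]`
with `deg det A ≤ n`, the gradient of `hc_n (det A)` has a NONZERO common zero (dichotomy on the
pencil of `A`, module docstring). [cite: KumarVolk2022b, §3] -/
theorem exists_ne_zero_grad_topForm_det_eq_zero {m n k : ℕ} (hm : m = n + k) (hn : 3 ≤ n)
    (hw : 2 * k + 7 ≤ w) (A : Matrix (Fin m) (Fin m) (MvPolynomial (Fin w) ℂ))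
    (hA : ∀ i j, (A i j).totalDegree ≤ 1) (hdeg : A.det.totalDegree ≤ n) :
    ∃ ζ : Fin w → ℂ, ζ ≠ 0 ∧ ∀ i, eval ζ (pderiv i (homogeneousComponent n A.det)) = 0 := by
  classical
  subst hm
  by_cases hg : homogeneousComponent n A.det = 0
  · refine ⟨fun _ => 1, ?_, fun i => by rw [hg, map_zero, map_zero]⟩
    intro h
    have := congrFun h ⟨0, by omega⟩
    exact one_ne_zero this
  have hdegn : A.det.totalDegree = n := by
    refine le_antisymm hdeg (not_lt.1 fun hlt => hg (homogeneousComponent_eq_zero n _ hlt))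
  set Pm := A.map (homogenizeTo 1) with hPm
  by_cases hrad : (X none : MvPolynomial (Option (Fin w)) ℂ) ∈ (VonZurGathen.adjIdeal Pm).radical
  swap
  · -- case A
    rw [← Ideal.sInf_minimalPrimes, Submodule.mem_sInf] at hrad
    push Not at hrad
    obtain ⟨𝔭, h𝔭, hX⟩ := hrad
    exact exists_ne_zero_grad_eq_zero_of_not_mem_minimalPrime (by omega) (by omega) A hA hdeg
      (by omega) h𝔭 hX
  -- case B: a zero `v` of `det A`, where `A(v)` has corank exactly one
  obtain ⟨v, hv⟩ := exists_eval_eq_zero_of_totalDegree_ne_zero A.det (by omega)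
  have hadj := adjugate_map_eval_ne_zero_of_X_mem_radical A hrad v
  have hdet0 : (A.map (eval v)).det = 0 := by
    rw [← RingHom.mapMatrix_apply, ← RingHom.map_det, hv]
  have hrank := DeterminantalConormal.rank_eq_of_det_eq_zero_of_adjugate_ne_zero hdet0 hadj
  -- the translated affine matrix `A(v) + A₁(x)`
  set Mv : Matrix (Fin (n + k)) (Fin (n + k)) (MvPolynomial (Fin w) ℂ) :=
    Matrix.of (fun i j => C (eval v (A i j)) + homogeneousComponent 1 (A i j)) with hMvdef
  have hMvij : ∀ i j, Mv i j = C (eval v (A i j)) + homogeneousComponent 1 (A i j) :=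
    fun i j => rfl
  have hdeg1 : ∀ i j, (C (eval v (A i j)) + homogeneousComponent 1 (A i j)).totalDegree ≤ 1 :=
    fun i j => by
      refine (totalDegree_add _ _).trans (max_le ?_ ?_)
      · rw [totalDegree_C]; exact Nat.zero_le _
      · exact (homogeneousComponent_isHomogeneous 1 (A i j)).totalDegree_le
  have hMv1 : ∀ i j, (Mv i j).totalDegree ≤ 1 := fun i j => by rw [hMvij]; exact hdeg1 i j
  have hMvconst : constPart Mv = A.map (eval v) := by
    ext i j
    rw [constPart_apply, Matrix.map_apply, hMvij, map_add, constantCoeff_C]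
    have : constantCoeff (homogeneousComponent 1 (A i j)) = 0 := by
      rw [constantCoeff_eq]
      exact (homogeneousComponent_isHomogeneous 1 (A i j)).coeff_eq_zero (by
        rw [map_zero]; exact zero_ne_one)
    rw [this, add_zero]
  have hMv0 : constantCoeff Mv.det = 0 := by rw [← det_constPart, hMvconst, hdet0]
  have hMvrank : (constPart Mv).rank = n + k - 1 := by rw [hMvconst, hrank]
  -- the linear substitution `ψ : x ↦ x + x₀ v`, `x₀ ↦ x₀`
  let ψ : MvPolynomial (Option (Fin w)) ℂ →ₐ[ℂ] MvPolynomial (Option (Fin w)) ℂ :=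
    aeval fun o : Option (Fin w) =>
      (o.elim (X none) (fun i => X (some i) + C (v i) * X none) : MvPolynomial (Option (Fin w)) ℂ)
  have hψX : ψ (X none) = X none := by simp [ψ]
  have hψentry : ∀ i j, ψ (Pm i j) = (Mv.map (homogenizeTo 1)) i j := by
    intro i j
    rw [hPm, Matrix.map_apply, Matrix.map_apply, hMvij,
      homogenizeTo_one_eq _ (hA i j), homogenizeTo_one_eq _ (hdeg1 i j), map_add, map_mul, aeval_C,
      algebraMap_eq, hψX]
    have hℓ0 : coeff 0 (homogeneousComponent 1 (A i j)) = 0 :=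
      (homogeneousComponent_isHomogeneous 1 (A i j)).coeff_eq_zero (by
        rw [map_zero]; exact zero_ne_one)
    rw [show ψ (rename some (homogeneousComponent 1 (A i j))) = _ from
      aeval_translate_rename_of_isHomogeneous_one v _
        ((homogeneousComponent_isHomogeneous 1 (A i j)).totalDegree_le) hℓ0]
    -- constant and linear parts of the translated entry
    have hc0 : coeff 0 (C (eval v (A i j)) + homogeneousComponent 1 (A i j)) = eval v (A i j) := by
      rw [coeff_add, coeff_zero_C, hℓ0, add_zero]
    have hc1 : homogeneousComponent 1 (C (eval v (A i j)) + homogeneousComponent 1 (A i j)) =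
        homogeneousComponent 1 (A i j) := by
      rw [map_add, homogeneousComponent_of_mem (isHomogeneous_C _ _), if_neg one_ne_zero, zero_add,
        homogeneousComponent_of_mem (homogeneousComponent_isHomogeneous 1 (A i j)), if_pos rfl]
    rw [hc0, hc1]
    have hev : eval v (A i j) = coeff 0 (A i j) + eval v (homogeneousComponent 1 (A i j)) := by
      conv_lhs => rw [eq_homogeneousComponent_zero_add_one (hA i j), homogeneousComponent_zero]
      rw [map_add, eval_C]
    rw [hev, map_add]
    ring
  have hψdet : ψ Pm.det = (Mv.map (homogenizeTo 1)).det := by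
    rw [AlgHom.map_det]
    exact congrArg Matrix.det (Matrix.ext fun i j => hψentry i j)
  set G := homogenizeTo n A.det with hG
  have hPmdet : Pm.det = X none ^ k * G := by
    rw [hPm, det_map_homogenizeTo_one A hA, homogenizeTo_add_right hdeg]
  have hGhom : (ψ G).IsHomogeneous n := by
    have h := (homogenizeTo_isHomogeneous hdeg).eval₂ (algebraMap ℂ (MvPolynomial (Option (Fin w)) ℂ))
      (fun o : Option (Fin w) =>
        (o.elim (X none) (fun i => X (some i) + C (v i) * X none) : MvPolynomial (Option (Fin w)) ℂ))
      (fun r => isHomogeneous_C _ r) (fun o => by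
        cases o with
        | none => simpa using isHomogeneous_X ℂ (none : Option (Fin w))
        | some i =>
          refine IsHomogeneous.add (isHomogeneous_X ℂ _) ?_
          simpa using (isHomogeneous_C (Option (Fin w)) (v i)).mul (isHomogeneous_X ℂ none))
    rw [one_mul] at h
    exact h
  -- the dehomogenization `f'` of `ψ G`: `det Mv = f'`, so `deg det Mv ≤ n` and top form preserved
  set f' := dehomogenization (ψ G) with hf'
  have hf'deg : f'.totalDegree ≤ n := totalDegree_dehomogenization_le hGhom
  have hψG : ψ G = homogenizeTo n f' := eq_homogenizeTo_of_isHomogeneous hGhom rfl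
  have hMvdet : Mv.det = f' := by
    have h1 : (Mv.map (homogenizeTo 1)).det = homogenizeTo (n + k) Mv.det :=
      det_map_homogenizeTo_one Mv hMv1
    have h2 : (Mv.map (homogenizeTo 1)).det = homogenizeTo (n + k) f' := by
      rw [← hψdet, hPmdet, map_mul, map_pow, hψX, hψG, homogenizeTo_add_right hf'deg]
    have h3 := congrArg dehomogenization (h1.symm.trans h2)
    rwa [dehomogenization_homogenizeTo, dehomogenization_homogenizeTo] at h3
  have htop : homogeneousComponent n Mv.det = homogeneousComponent n A.det := by
    rw [hMvdet, ← aeval_elim_zero_homogenizeTo f' hf'deg, ← hψG, ← AlgHom.comp_apply,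
      ← aeval_elim_zero_homogenizeTo A.det hdeg, ← hG]
    congr 1
    refine MvPolynomial.algHom_ext fun o => ?_
    rw [AlgHom.comp_apply]
    cases o with
    | none => simp [ψ]
    | some i => simp [ψ]
  obtain ⟨s, rfl⟩ : ∃ s, n = s + 3 := ⟨n - 3, by omega⟩
  have hsz : s + 3 + k = (k + 1 + 1) + (s + 1) := by omega
  let Mb : Matrix (Fin ((k + 1 + 1) + (s + 1))) (Fin ((k + 1 + 1) + (s + 1))) (MvPolynomial (Fin w) ℂ) :=
    Mv.submatrix ⇑(finCongr hsz.symm) ⇑(finCongr hsz.symm)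
  have hMbdet : Mb.det = Mv.det := Matrix.det_submatrix_equiv_self _ _
  have hMb1 : ∀ i j, (Mb i j).totalDegree ≤ 1 := fun i j => hMv1 _ _
  have hMb0 : constantCoeff Mb.det = 0 := by rw [hMbdet, hMv0]
  have hMbrank : (constPart Mb).rank = (k + 1) + (s + 1) := by
    have : constPart Mb = (constPart Mv).submatrix ⇑(finCongr hsz.symm) ⇑(finCongr hsz.symm) := rfl
    rw [this, Matrix.rank_submatrix, hMvrank]
    omega
  have hMbdeg : Mb.det.totalDegree ≤ s + 3 := by rw [hMbdet, hMvdet]; exact hf'deg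
  obtain ⟨ζ, hζ, hgrad⟩ := exists_ne_zero_grad_eq_zero_caseB (k' := k + 1) (by omega) (by omega)
    Mb hMb1 hMb0 hMbrank hMbdeg
  refine ⟨ζ, hζ, fun i => ?_⟩
  rw [← htop, ← hMbdet]
  exact hgrad i

end Summit.ValiantsHypothesis.ValiantsHypothesis.Theorems.BarrierLever.DcConstantExcess

end
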